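import Literature.Analysis.FluidPDE.TaoFiniteEnergyLerayHopf
import HarnessLib

/-!
# Leray's energy equality for finite-energy classical solutions on `ℝ³`, unconditionally and in
# the printed real form `‖u(t)‖²₂ + 2ν ∫ₛᵗ ‖∇u‖²₂ = ‖u(s)‖²₂`

Analysis/FluidPDE **proofs file** (theorems only: no definitions, no named facts, no `sorry`).
The tree proves the sharp energy equality for classical solutions of the unforced Navier–Stokes
system on a closed slab `[0, T] × ℝ³` with finite energy
(`IsClassicalNSSolutionOn.energyEq_of_finiteEnergy`, Tao 2013 Lemma 8.1 in sharp form = Leray 1934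
(3.4)) modulo three inputs which are all theorems of the tree
(`tao_pressure_normalisation_holds`, `tao2011_pressureTerm_estimate_holds`,
`tao_finite_energy_smooth_energy_bound_holds`), with the dissipation written as a lower Lebesgue
integral `(∫⁻_{(s,t)} ∫⁻ |∇u|²_F).toReal` and the energy as `VectorCalculus.kineticEnergy = ½∫|u|²`.
This file records

* `IsClassicalNSSolutionOn.energyEq_finiteEnergy` — the unconditional form of that equality (the
  three inputs supplied);
* (private plumbing) the dissipation in the PRINTED real form, `∫ τ in s..t, ∫ x, |∇u(τ,x)|²_F dx dτ`
  (iterated Bochner integrals), equals the lower-integral form;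
* `IsClassicalNSSolutionOn.integral_norm_sq_add_dissipation_eq` — **Leray's energy equality as
  printed**: `∫|u(t)|² + 2ν ∫ₛᵗ∫|∇u|²_F = ∫|u(s)|²` for `0 ≤ s ≤ t ≤ T`, for every classical
  solution on `[0, T] × ℝ³` (`ν > 0`) with `sup_{[0,T]} ∫|u|² < ∞` — no decay, integrability or
  pressure hypothesis beyond finite energy (they are consequences: Tao 2013, Lemma 8.1);
* `…integral_norm_sq_add_dissipation_le`, `…integral_norm_sq_le_of_finiteEnergy`,
  `…dissipation_le_of_finiteEnergy` — the energy inequality, monotonicity of the energy, and the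
  dissipation bound `2ν∫₀ᵗ∫|∇u|²_F ≤ ∫|u(0)|²` in the same real form.

These are the shapes in which manuscripts print «the energy inequality» as the first step of an
a priori argument (D-0090 claims cell: e.g. `Literature.Claims.NS.Durmagambetov2015.Step3_energy39`,
(39) p. 93, whose `energy`/`dissipation` are exactly the two real integrals here).

## References

* J. Leray, Acta Math. 63 (1934), §17, (3.4) p. 220 («relation de dissipation de l'énergie»).
  [Leray1934]
* T. Tao, Anal. PDE 6 (2013) = arXiv:1108.1165, Lemma 8.1 (with Lemma 4.1 (i)). [Tao2011]
* W. S. Ożański, B. C. Pooley, *Leray's fundamental work on the Navier–Stokes equations*,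
  LMS Lecture Note Ser. 452 (2018), Lemma 6.21 / Thm. 1.7. [OzanskiPooley2018]
-/

noncomputable section

open MeasureTheory Set Function Filter
open scoped ENNReal NNReal ContDiff Topology

namespace Literature.Analysis.FluidPDE

variable {ν T : ℝ} {u : ℝ → EuclideanSpace ℝ (Fin 3) → EuclideanSpace ℝ (Fin 3)}
  {p : ℝ → EuclideanSpace ℝ (Fin 3) → ℝ}

/-- **Leray's energy equality for finite-energy classical solutions, unconditionally** (Tao 2013,
Lemma 8.1, sharp form; Leray 1934 (3.4)): for a classical solution of the unforced system on
`[0, T] × ℝ³`, `ν > 0`, with `sup_{[0,T]} ∫|u|² < ∞`, and `0 ≤ s ≤ t ≤ T`,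
`½‖u(t)‖₂² + ν ∫ₛᵗ∫|∇u|²_F = ½‖u(s)‖₂²` (dissipation as a lower integral). The tree's
`IsClassicalNSSolutionOn.energyEq_of_finiteEnergy` with its three inputs supplied by the tree's
`tao_pressure_normalisation_holds`, `tao2011_pressureTerm_estimate_holds`,
`tao_finite_energy_smooth_energy_bound_holds` (the gradient and `L³` integrability are read off
`energyClass_of_finiteEnergy` and `lintegral_enorm_pow_three_lt_top`).
[cite: Tao2011, Lemma 8.1] [cite: Leray1934, §17 (3.4) p. 220] -/
theorem IsClassicalNSSolutionOn.energyEq_finiteEnergy (h : IsClassicalNSSolutionOn (Icc 0 T) ν 0 u p)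
    (hν : 0 < ν) (hT : 0 < T)
    (hfe : ∃ A : ℝ≥0∞, A < ⊤ ∧ ∀ t ∈ Icc 0 T, ∫⁻ x, ‖u t x‖ₑ ^ 2 ≤ A)
    {s t : ℝ} (hs : 0 ≤ s) (hst : s ≤ t) (ht : t ≤ T) :
    VectorCalculus.kineticEnergy (u t) +
      ν * (∫⁻ τ in Ioo s t, ∫⁻ x, ENNReal.ofReal (frobeniusNormSq (fderiv ℝ (u τ) x))).toReal =
      VectorCalculus.kineticEnergy (u s) := by
  obtain ⟨A, hAt, hA, -, hgrad⟩ := Literature.Analysis.FluidPDE.energyClass_of_finiteEnergy h hν hT hfe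
  have hu₃ := h.lintegral_enorm_pow_three_lt_top hAt hA hgrad
  exact h.energyEq_of_finiteEnergy tao_pressure_normalisation_holds
    tao2011_pressureTerm_estimate_holds hν hT hAt hA hgrad hu₃ hs hst ht

/-- **The slice dissipation `τ ↦ ∫⁻ |∇u(τ)|²_F` of a classical solution on `[0, T]` is a.e.
measurable on every `(s, t) ⊆ [0, T]`** (Tonelli measurability of the jointly continuous
integrand, after reparametrising time through the continuous projection onto `[0, T]`). [folklore] -/
private theorem IsClassicalNSSolutionOn.aemeasurable_lintegral_frobeniusNormSq_fderiv {f : ℝ → EuclideanSpace ℝ (Fin 3) → EuclideanSpace ℝ (Fin 3)}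
    (h : IsClassicalNSSolutionOn (Icc 0 T) ν f u p) (hT : 0 < T) {s t : ℝ} (hs : 0 ≤ s)
    (ht : t ≤ T) :
    AEMeasurable (fun τ => ∫⁻ x, ENNReal.ofReal (frobeniusNormSq (fderiv ℝ (u τ) x)))
      (volume.restrict (Ioo s t)) := by
  -- reparametrise time through `projIcc 0 T`, which is the identity on `(s, t) ⊆ [0, T]`
  set π : ℝ → ℝ := fun τ => (projIcc 0 T hT.le τ : ℝ) with hπ
  have hπc : Continuous π := continuous_subtype_val.comp continuous_projIcc
  have hπmem : ∀ τ, π τ ∈ Icc 0 T := fun τ => (projIcc 0 T hT.le τ).2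
  have hcont : ContinuousOn (fun z : ℝ × EuclideanSpace ℝ (Fin 3) => fderiv ℝ (u z.1) z.2)
      (Icc 0 T ×ˢ univ) :=
    (h.smooth_velocity.fderiv_slice (uniqueDiffOn_Icc hT)).continuousOn
  have hD : Continuous fun z : ℝ × EuclideanSpace ℝ (Fin 3) => fderiv ℝ (u (π z.1)) z.2 := by
    have h1 : Continuous fun z : ℝ × EuclideanSpace ℝ (Fin 3) => (π z.1, z.2) :=
      (hπc.comp continuous_fst).prodMk continuous_snd
    exact hcont.comp_continuous h1 fun z => ⟨hπmem z.1, mem_univ _⟩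
  have hm : Measurable fun τ => ∫⁻ x, ENNReal.ofReal (frobeniusNormSq (fderiv ℝ (u (π τ)) x)) := by
    have hm2 : Measurable fun z : ℝ × EuclideanSpace ℝ (Fin 3) =>
        ENNReal.ofReal (frobeniusNormSq (fderiv ℝ (u (π z.1)) z.2)) :=
      (LerayHopfProofs.continuous_frobeniusNormSq.comp hD).measurable.ennreal_ofReal
    exact hm2.lintegral_prod_right'
  refine ⟨_, hm, ?_⟩
  filter_upwards [self_mem_ae_restrict measurableSet_Ioo] with τ hτ
  have hτI : τ ∈ Icc 0 T := ⟨hs.trans hτ.1.le, hτ.2.le.trans ht⟩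
  have hπτ : π τ = τ := by
    simp only [hπ, projIcc_of_mem hT.le hτI]
  simp only [hπτ]

/-- **The printed dissipation equals the lower-integral dissipation**: for a classical solution on
`[0, T] × ℝ³` with `∫⁻_{(0,T)}∫⁻|∇u|²_F < ∞` and `0 ≤ s ≤ t ≤ T`,
`∫ τ in s..t, ∫ x, |∇u(τ,x)|²_F = (∫⁻_{(s,t)} ∫⁻ |∇u|²_F).toReal` (each slice integral is the
`toReal` of the slice lower integral, `integral_eq_lintegral_of_nonneg_ae`; the slices are a.e.
finite, `integral_toReal`). [folklore] -/
private theorem IsClassicalNSSolutionOn.intervalIntegral_integral_frobeniusNormSq_eq_toReal {f : ℝ → EuclideanSpace ℝ (Fin 3) → EuclideanSpace ℝ (Fin 3)}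
    (h : IsClassicalNSSolutionOn (Icc 0 T) ν f u p) (hT : 0 < T)
    (hgrad : ∫⁻ τ in Ioo 0 T, ∫⁻ x, ENNReal.ofReal (frobeniusNormSq (fderiv ℝ (u τ) x)) < ⊤)
    {s t : ℝ} (hs : 0 ≤ s) (hst : s ≤ t) (ht : t ≤ T) :
    ∫ τ in s..t, ∫ x, frobeniusNormSq (fderiv ℝ (u τ) x) =
      (∫⁻ τ in Ioo s t, ∫⁻ x, ENNReal.ofReal (frobeniusNormSq (fderiv ℝ (u τ) x))).toReal := by
  have hslice : ∀ τ ∈ Icc 0 T, ∫ x, frobeniusNormSq (fderiv ℝ (u τ) x) =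
      (∫⁻ x, ENNReal.ofReal (frobeniusNormSq (fderiv ℝ (u τ) x))).toReal := by
    intro τ hτ
    refine integral_eq_lintegral_of_nonneg_ae (Eventually.of_forall fun x => frobeniusNormSq_nonneg _)
      ?_
    have hc : Continuous fun x => frobeniusNormSq (fderiv ℝ (u τ) x) :=
      LerayHopfProofs.continuous_frobeniusNormSq.comp
        ((h.contDiff_velocity hτ).continuous_fderiv (by simp))
    exact hc.aestronglyMeasurable
  have hmeas := h.aemeasurable_lintegral_frobeniusNormSq_fderiv hT hs ht
  have hfin : ∀ᵐ τ ∂(volume.restrict (Ioo s t)),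
      (∫⁻ x, ENNReal.ofReal (frobeniusNormSq (fderiv ℝ (u τ) x))) < ⊤ := by
    refine ae_lt_top' hmeas (lt_of_le_of_lt ?_ hgrad).ne
    exact lintegral_mono_set (Ioo_subset_Ioo hs ht)
  rw [intervalIntegral.integral_of_le hst, integral_Ioc_eq_integral_Ioo,
    setIntegral_congr_fun measurableSet_Ioo fun τ hτ =>
      hslice τ ⟨hs.trans hτ.1.le, hτ.2.le.trans ht⟩,
    integral_toReal hmeas hfin]

/-- **Leray's energy equality in the printed real form** (Leray 1934, §17 (3.4): «relation de
dissipation de l'énergie» `ν ∫_{t₀}^t J²(t') dt' + ½ W(t) = ½ W(t₀)`; Tao 2013 Lemma 8.1). Let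
`(u, p)` be a classical solution of the unforced Navier–Stokes system on `[0, T] × ℝ³`, `ν > 0`,
`T > 0`, with finite energy `sup_{[0,T]} ∫|u(t)|² < ∞`. Then for `0 ≤ s ≤ t ≤ T`,
`∫ |u(t,x)|² dx + 2ν ∫ₛᵗ ∫ |∇u(τ,x)|²_F dx dτ = ∫ |u(s,x)|² dx` (iterated Bochner integrals).
[cite: Leray1934, §17 (3.4) p. 220] [cite: Tao2011, Lemma 8.1] -/
theorem IsClassicalNSSolutionOn.integral_norm_sq_add_dissipation_eq
    (h : IsClassicalNSSolutionOn (Icc 0 T) ν 0 u p) (hν : 0 < ν) (hT : 0 < T)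
    (hfe : ∃ A : ℝ≥0∞, A < ⊤ ∧ ∀ t ∈ Icc 0 T, ∫⁻ x, ‖u t x‖ₑ ^ 2 ≤ A)
    {s t : ℝ} (hs : 0 ≤ s) (hst : s ≤ t) (ht : t ≤ T) :
    (∫ x, ‖u t x‖ ^ 2) + 2 * ν * ∫ τ in s..t, ∫ x, frobeniusNormSq (fderiv ℝ (u τ) x) =
      ∫ x, ‖u s x‖ ^ 2 := by
  obtain ⟨A, hAt, hA, -, hgrad⟩ := Literature.Analysis.FluidPDE.energyClass_of_finiteEnergy h hν hT hfe
  have hE := h.energyEq_finiteEnergy hν hT hfe hs hst ht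
  rw [h.intervalIntegral_integral_frobeniusNormSq_eq_toReal hT hgrad hs hst ht]
  simp only [VectorCalculus.kineticEnergy] at hE
  linarith

/-- **The energy inequality in the printed real form**: `∫|u(t)|² + 2ν∫ₛᵗ∫|∇u|²_F ≤ ∫|u(s)|²`
(the `≤` half of `integral_norm_sq_add_dissipation_eq`, which is what a priori arguments use).
[cite: Leray1934, §17 (3.4) p. 220] [cite: Tao2011, Lemma 8.1] -/
theorem IsClassicalNSSolutionOn.integral_norm_sq_add_dissipation_le
    (h : IsClassicalNSSolutionOn (Icc 0 T) ν 0 u p) (hν : 0 < ν) (hT : 0 < T)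
    (hfe : ∃ A : ℝ≥0∞, A < ⊤ ∧ ∀ t ∈ Icc 0 T, ∫⁻ x, ‖u t x‖ₑ ^ 2 ≤ A)
    {s t : ℝ} (hs : 0 ≤ s) (hst : s ≤ t) (ht : t ≤ T) :
    (∫ x, ‖u t x‖ ^ 2) + 2 * ν * ∫ τ in s..t, ∫ x, frobeniusNormSq (fderiv ℝ (u τ) x) ≤
      ∫ x, ‖u s x‖ ^ 2 :=
  (h.integral_norm_sq_add_dissipation_eq hν hT hfe hs hst ht).le

/-- **The energy is non-increasing**: `∫|u(t)|² ≤ ∫|u(s)|²` for `0 ≤ s ≤ t ≤ T` along a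
finite-energy classical solution of the unforced system (`ν > 0`).
[cite: Leray1934, §17 (3.4) p. 220] [cite: Tao2011, Lemma 8.1] -/
theorem IsClassicalNSSolutionOn.integral_norm_sq_le_of_finiteEnergy
    (h : IsClassicalNSSolutionOn (Icc 0 T) ν 0 u p) (hν : 0 < ν) (hT : 0 < T)
    (hfe : ∃ A : ℝ≥0∞, A < ⊤ ∧ ∀ t ∈ Icc 0 T, ∫⁻ x, ‖u t x‖ₑ ^ 2 ≤ A)
    {s t : ℝ} (hs : 0 ≤ s) (hst : s ≤ t) (ht : t ≤ T) :
    ∫ x, ‖u t x‖ ^ 2 ≤ ∫ x, ‖u s x‖ ^ 2 := by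
  have hE := h.integral_norm_sq_add_dissipation_eq hν hT hfe hs hst ht
  have hD : 0 ≤ ∫ τ in s..t, ∫ x, frobeniusNormSq (fderiv ℝ (u τ) x) :=
    intervalIntegral.integral_nonneg hst fun τ _ => integral_nonneg fun x => frobeniusNormSq_nonneg _
  nlinarith

/-- **The dissipation bound**: `2ν ∫₀ᵗ∫|∇u|²_F ≤ ∫|u(0)|²` for `0 ≤ t ≤ T` along a finite-energy
classical solution of the unforced system (`ν > 0`).
[cite: Leray1934, §17 (3.4) p. 220] [cite: Tao2011, Lemma 8.1] -/
theorem IsClassicalNSSolutionOn.dissipation_le_of_finiteEnergy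
    (h : IsClassicalNSSolutionOn (Icc 0 T) ν 0 u p) (hν : 0 < ν) (hT : 0 < T)
    (hfe : ∃ A : ℝ≥0∞, A < ⊤ ∧ ∀ t ∈ Icc 0 T, ∫⁻ x, ‖u t x‖ₑ ^ 2 ≤ A)
    {t : ℝ} (ht0 : 0 ≤ t) (ht : t ≤ T) :
    2 * ν * ∫ τ in (0 : ℝ)..t, ∫ x, frobeniusNormSq (fderiv ℝ (u τ) x) ≤ ∫ x, ‖u 0 x‖ ^ 2 := by
  have hE := h.integral_norm_sq_add_dissipation_eq hν hT hfe le_rfl ht0 ht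
  have h0 : 0 ≤ ∫ x, ‖u t x‖ ^ 2 := integral_nonneg fun x => sq_nonneg _
  linarith

end Literature.Analysis.FluidPDE

end
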